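import Summits.QuantumFields.YangMills.Theorems.BalabanUVNodesN21GappedTopReading13CoPH
import Summits.QuantumFields.YangMills.Theorems.BalabanUVNodesN20KeyedRelWeightLevels

/-!
# BalabanUVNodes ∕ N20 (NE7b) — THE N20 COLUMN AT dag-n21-d's GAPPED TOP-LETTERED SPINE READING `crGap₁₃VAt N K₀ jcut ρ n`: the weight face `KeyedRelWeight` of stub 2
# read at the reading on which N21's `KeyedShellWeight` is a THEOREM (p622874 ∕ p626047) — FREE at the zero cut (hypothesis-free), two numeric conditions on ONE canonical
# sequence at every cut, `= 1` above the window on the live line, priced by per-birth-level fractions ∕ a survival rate, walled by first-level saturation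

Cell `pub-ymgap` (HUMAN RULING D-0062 Track A; width push D-0149, director-ym №197), width seat `pub-ymgap-dag-n20-w2` (gen 5) on node N20 = NE7b; key item K3⁸
`SpineGivenEndpointR13SepCoPHV` = stmt-QuantumFields-27366 (KEY MAP v2; K3⁷ stmt-QuantumFields-20544 aside); `--kind proof --supports … --as helper`; COUNT-NEUTRAL; LOCATED.
[III] = [Balaban1988Convergent], [LF-I] = [Balaban1989LargeFieldI], [LF-II] = [Balaban1989LargeFieldII].

WHY.  dag-n21-d g11's `GAPPED-TOP-CUT-N21D.md` (evidence on 27366) tabulates what a K3 pin naming the gapped reading `crGap₁₃V jc ρ n` would read: `KeyedShellWeight` and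
`KeyedExtraction` are THEOREMS there (`shellWeightBound_crGap₁₃VAt`, `keyedExtraction_crGap₁₃VAt`), the N19′ core a transfer, and `KeyedRelWeight` «a transfer from any N20 witness at
the gapped carriers» ONLY.  This lineage typed the N20 face at n20-d's readings `crOfRecord₁₃(V)At` (g0 p590852, g2 p597397–p604310, g3 p606933) and `crOfRecord₁₃KAt` (g3∕g4);
nobody typed it at the gapped carriers `gapWeightA₁₃ ∕ gapWeightB₁₃` (same index type, class set `classSet₁₃`, persistence class `badClass₁₃ … jcut`, canonical `W := wInf …` — only
the carriers differ).  This file is that column, BY NAME over n21-d's dictionary and this lineage's generic lemmas: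
* §1 `gapWeightA₁₃_nonneg ∕ gapWeightB₁₃_nonneg` (n21-d `topTermAtLevel_nonneg` + the provisos' ζ-rows) · `one_mem_admW_carriersGap₁₃`;
* §2 THE FREE END: ★★ `relWeightBound_carriersGap₁₃_cutZero` (zero cut, zero weight — HYPOTHESIS-FREE) · ★★ `relWeightBound_crGap₁₃VAt_cutZero` · `W_crGap₁₃VAt_cutZero` (`W ≡ 0`);
* §3 CANONICAL FORM, ANY CUT: `W_crGap₁₃VAt_le_one ∕ _mem_Icc` · `badMass_le_W_crGap₁₃VAt_left ∕ _right` · ★★ `relWeightBound_crGap₁₃VAt_iff` (`RelWeightBound` at the reading ⟺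
  `(∀ K, W K < 1) ∧ Summable W`) · `exists_relWeightBound_carriersGap₁₃_iff`;
* §4 THE DIAL: `W_crGap₁₃VAt_mono_at` · ★ `W_crGap₁₃VAt_eq_one_of_overCut` (live line, (H-ζ): `K₀ + K < jcut K ⇒ W K = 1`, by n21-d's E1 at the gapped reading + positivity of the
  dressed partition function of record) · `cut_le_of_relWeightBound_crGap₁₃VAt` (an N20 witness keeps the cut inside the window);
* §5 THE WALL: `le_weight_of_levelOne_fraction_carriersGap₁₃` · ★ `eventually_cut_eq_zero_of_relWeightBound_carriersGap₁₃ ∕ _crGap₁₃VAt` (EVENTUAL first-level saturation of the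
  gapped run-A carriers, DISPLAYED, + any witness ⇒ `∀ᶠ K, jcut K = 0` — dag-n20-w1's policy wall p597932 re-derived at the gapped carriers);
* §6 THE K3 BINDER SHAPES (`N = 2`, per-tuple cut reading `jc`): ★★ `keyedRelWeight_shape_crGap₁₃V_cutZero` (HYPOTHESIS-FREE — the N20 conjunct of a gapped pin at `jc ≡ 0`) ·
  `keyedRelWeight_shape_crGap₁₃V_iff`.  The interior PRICED (per-birth-level fractions, print's survival shape) is the companion module `…AtGappedReadingLevels`.
WHAT IT SAYS (located, count-neutral): at a gapped pin the N20 conjunct is the SAME object as at the pin of record up to the carriers — free at `jc ≡ 0` (§2, §7), impossible above the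
window on the live line (§4), monotone in between, idle under first-level saturation (§5, the count DISPLAYED); its interior is priced in the companion module.  With
n21-d's two theorems, THREE of the four faces of a gapped pin at `jc ≡ 0` are estimate-free BY NAME (rows `hsel` ∕ (H-ζ) ∕ dials ∕ `0 ≤ ε` on the N21 side); the two-run content
then sits in the N19′ core on ALL keyed classes at the GAPPED cores (`core_crGap₁₃VAt`) — plan's v11 BOOKING (5), read at the gapped reading.
Cited BY NAME, not re-typed: dag-n21-d `…N21GappedTopReading13CoPH(Defs)` ∕ `…N21TopLetteredReading13CoPH`; dag-n20-d `…SpineReadingOfRecord13CoPH` ∕ `…SpineCanonicalWeights` ∕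
`…N20AtRecord13CoPH`; this lineage g0 `…CutZero`, `…N21KeyedShellWeightShellZero`, g2 `…OverCut` ∕ `…Canonical` ∕ `…DialMonotone`; dag-n20-w1 `…PolicyWall`;
`T4BadClassBooking`, `T4ShellCount`.

HONEST FRAMING.  [folklore] finite-sum ∕ real-analysis bookkeeping BY NAME; NO weight bounded, NO estimate proved; the saturation letter is a
HYPOTHESIS (dag-n20-w3's saturation count — DISPLAYED); nothing of Bałaban's is asserted; NE7 ∕ NE7b ∕ NE7c NOT PRINTED for `d = 4`,
NOT proved; the gapped reading is NOT the registered v6 `PinnedAtLive` pin (which names `crOfRecord₁₃V` — a gapped pin is the PLANNER's call; LOCATED by n21-d); no `Provisos₁₃CoPH`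
inhabitant claimed (K0⁷ OPEN); N19 ∕ N20 ∕ N21 ∕ N27 NOT discharged; K3⁸ ∕ K3⁷ NOT closed (v6 ∕ v5 stand); counts unmoved (typed 28∕28 · discharged 5∕27); no count claim (the
chair's single count line is the only count).  One finite `𝕋⁴_{L^K}` programme at fixed `ε = L^{−K}`, Bałaban AS PRINTED; the YM mass gap (Clay) is NOT proved by any of this —
R4 closes the conditional finite-𝕋⁴ rung `BalabanLadder.UV` only; NOT ℝ⁴, NOT infinite volume, NOT OS.  No `def`, no `instance`, no `notation`, no `sorry`.
Sources (locators, bookkeeping only): [III] (2.18) p.257; [LF-I] p.181; [LF-II] Thm 1 + (0.1) pp.355–356, (1.80) p.384, (1.89) p.387; [King1986] (3.10)–(3.11) p.656.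
-/

noncomputable section

open scoped BigOperators
open Filter

namespace Summit.QuantumFields.YangMills.BalabanUVNodes.N20KeyedRelWeightAtGappedReading

open Literature.MathematicalPhysics.QuantumFieldTheory.Balaban1983to89 Literature.MathematicalPhysics.QuantumFieldTheory.Balaban1983to89.Node00
open T4Continuum
open T4WeightBudget (RelWeightBound)
open T4BadClassBooking (le_weight_of_fraction_le le_weight_of_fraction_le_right)
open T4ShellCount (not_summable_of_frequently_le)
open YMDAG.UVSplit (SpineReading₁₃CoPH keyA₁₃ keyB₁₃ runA₁₃ runB₁₃ histA₁₃ histB₁₃ classSet₁₃ badClass₁₃ badClass₁₃_subset)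
open Summit.QuantumFields.YangMills.BalabanUVNodes.SpineCanonicalWeights
open Summit.QuantumFields.YangMills.Theorems.N21ShellSplitOfRecord13CoPH
open Summit.QuantumFields.YangMills.Theorems.N20AtRecord13 (schemeZ_pos_datumOfRecord₁₃CoPH)
open Summit.QuantumFields.YangMills.BalabanUVNodes.N20KeyedRelWeightCutZero (badClass₁₃_cutZero)
open Summit.QuantumFields.YangMills.BalabanUVNodes.N21KeyedShellWeightShellZero (zeta_nonneg_of_provisos₁₃CoPH)
open Summit.QuantumFields.YangMills.BalabanUVNodes.N20KeyedRelWeightOverCut (badClass₁₃_eq_classSet₁₃_of_overCut)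
open Summit.QuantumFields.YangMills.BalabanUVNodes.N20KeyedRelWeightCanonical (one_mem_admW bad_left_wInf bad_right_wInf relWeightBound_wInf_iff_lt_one_summable
  exists_relWeightBound_iff_lt_one_summable wInf_eq_one_of_bad_eq)
open Summit.QuantumFields.YangMills.BalabanUVNodes.N20KeyedRelWeightDialMonotone (wInf_mono_of_subset_at)
open Summit.QuantumFields.YangMills.BalabanUVNodes.N20KeyedRelWeightPolicyWall (badClass₁₃_mono_at badClass₁₃_levelOne_subset_of_one_le)

variable {F : T4Family} {N : ℕ} [NeZero N]

/-! ## §1  The gapped carriers are non-negative; the weight `1` is admissible -/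

section Carriers

variable (θ : Stage13HParams F N) (hP : θ.Provisos₁₃CoPH F N) (K₀ : ℕ) (g₀ : ℕ → ℝ) (os : List (ULoop F)) (ρ : ℕ → ℝ) (n : ℕ → ℕ)

/-- **`0 ≤` RUN A's GAPPED CLASS WEIGHT** at every key, step and source, at a Stage-13 tuple with core provisos (the top-lettered terms are `≥ 0`, n21-d's `topTermAtLevel_nonneg`,
from `0 ≤ ζ` — the provisos' rows `zeta_nonneg_of_provisos₁₃CoPH`). [cite: Balaban1988Convergent, (2.18) p.257; Balaban1989LargeFieldI, p.181 (bookkeeping)] -/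
theorem gapWeightA₁₃_nonneg (K : ℕ) (t : ℝ) (x : Σ K, SiteSeqKey F (K₀ + K)) : 0 ≤ gapWeightA₁₃ θ hP K₀ g₀ os ρ n K t x := by
  unfold gapWeightA₁₃
  exact Finset.sum_nonneg fun s _ =>
    topTermAtLevel_nonneg F N θ.toStage9Params (datumOfRecord₁₃CoPH F N θ hP) g₀ os (runA₁₃ F K₀ g₀ K) (histA₁₃ θ K₀ g₀ K)
      (zeta_nonneg_of_provisos₁₃CoPH F θ hP) _ t (K₀ + K) s

/-- **`0 ≤` RUN B's GAPPED CLASS WEIGHT.** [cite: Balaban1988Convergent, (2.18) p.257; Balaban1989LargeFieldI, p.181 (bookkeeping)] -/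
theorem gapWeightB₁₃_nonneg (K : ℕ) (t : ℝ) (x : Σ K, SiteSeqKey F (K₀ + K)) : 0 ≤ gapWeightB₁₃ θ hP K₀ g₀ os ρ n K t x := by
  unfold gapWeightB₁₃
  exact Finset.sum_nonneg fun s' _ =>
    topTermAtLevel_nonneg F N θ.toStage9Params (datumOfRecord₁₃CoPH F N θ hP) g₀ os (runB₁₃ F K₀ g₀ K) (histB₁₃ θ K₀ g₀ K)
      (zeta_nonneg_of_provisos₁₃CoPH F θ hP) _ t (K₀ + K + 1) s'

/-- **AT THE GAPPED CARRIERS THE WEIGHT `1` IS ADMISSIBLE AT EVERY STEP**, any cut (non-negative carriers; the persistence class consists of classes).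
[cite: King1986, (3.10)–(3.11) p.656 (bookkeeping)] -/
theorem one_mem_admW_carriersGap₁₃ (jcut : ℕ → ℕ) (K : ℕ) :
    (1 : ℝ) ∈ admW 1 (classSet₁₃ θ K₀ g₀) (gapWeightA₁₃ θ hP K₀ g₀ os ρ n) (gapWeightB₁₃ θ hP K₀ g₀ os ρ n) (badClass₁₃ θ K₀ g₀ jcut) K :=
  one_mem_admW (fun K t _ x _ => gapWeightA₁₃_nonneg θ hP K₀ g₀ os ρ n K t x) (fun K t _ x _ => gapWeightB₁₃_nonneg θ hP K₀ g₀ os ρ n K t x)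
    (fun K t _ => badClass₁₃_subset θ K₀ g₀ jcut K t) K

end Carriers

/-! ## §2  The free end: at the zero cut the N20 face at the gapped carriers ∕ reading holds OUTRIGHT -/

section CutZero

variable (θ : Stage13HParams F N) (hP : θ.Provisos₁₃CoPH F N) (K₀ : ℕ) (g₀ : ℕ → ℝ) (os : List (ULoop F))

/-- **★★ `RelWeightBound` AT THE GAPPED CARRIERS WITH THE ZERO CUT AND THE ZERO WEIGHT — HYPOTHESIS-FREE** (`badClass₁₃ … (fun _ ↦ 0) = ∅`: both bad sums vanish; `0 ≤ 0 < 1`,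
summable), every Stage-13 tuple with core provisos, every `K₀ g₀ os ρ n`. [cite: King1986, (3.10) p.656; Balaban1989LargeFieldII, (1.80) p.384 (bookkeeping)] -/
theorem relWeightBound_carriersGap₁₃_cutZero (ρ : ℕ → ℝ) (n : ℕ → ℕ) :
    RelWeightBound 1 (classSet₁₃ θ K₀ g₀) (gapWeightA₁₃ θ hP K₀ g₀ os ρ n) (gapWeightB₁₃ θ hP K₀ g₀ os ρ n) (badClass₁₃ θ K₀ g₀ (fun _ => 0)) (fun _ => 0) where
  bad_subset K t _ := badClass₁₃_subset θ K₀ g₀ _ K t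
  nonneg _ := le_rfl
  lt_one _ := zero_lt_one
  summable := summable_zero
  bad_left K t _ := by rw [badClass₁₃_cutZero, Finset.sum_empty, zero_mul]
  bad_right K t _ := by rw [badClass₁₃_cutZero, Finset.sum_empty, zero_mul]

variable (ρ : WidthLetter₁₃CoPH N) (n : DepthLetter₁₃CoPH N)

/-- **★★ THE N20 FACE AT THE GAPPED READING WITH THE ZERO CUT HOLDS FOR EVERY TUPLE, UNCONDITIONALLY** (the reading's canonical `W` inherits the zero witness by n21-d's
transfer `relWeightBound_crGap₁₃VAt`). [cite: King1986, (3.10) p.656; Balaban1989LargeFieldII, Thm 1 + (0.1) pp.355–356 (bookkeeping)] -/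
theorem relWeightBound_crGap₁₃VAt_cutZero :
    RelWeightBound (crGap₁₃VAt N K₀ (fun _ => 0) ρ n F θ hP g₀ os).l₀ (crGap₁₃VAt N K₀ (fun _ => 0) ρ n F θ hP g₀ os).T
      (crGap₁₃VAt N K₀ (fun _ => 0) ρ n F θ hP g₀ os).A (crGap₁₃VAt N K₀ (fun _ => 0) ρ n F θ hP g₀ os).B
      (crGap₁₃VAt N K₀ (fun _ => 0) ρ n F θ hP g₀ os).Bad (crGap₁₃VAt N K₀ (fun _ => 0) ρ n F θ hP g₀ os).W :=
  relWeightBound_crGap₁₃VAt K₀ _ ρ n θ hP g₀ os (relWeightBound_carriersGap₁₃_cutZero θ hP K₀ g₀ os _ _)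

/-- **DICTIONARY: AT THE ZERO CUT THE GAPPED READING's CANONICAL FRACTION IS `0`** at every step. [cite: King1986, (3.10) p.656 (bookkeeping)] -/
theorem W_crGap₁₃VAt_cutZero (K : ℕ) : (crGap₁₃VAt N K₀ (fun _ => 0) ρ n F θ hP g₀ os).W K = 0 :=
  le_antisymm (wInf_le_of_relWeightBound (relWeightBound_carriersGap₁₃_cutZero θ hP K₀ g₀ os _ _) K) (wInf_nonneg K)

end CutZero

/-! ## §3  Canonical form, any cut: the N20 face at the gapped reading is two numeric conditions on its own `W ∈ [0, 1]` -/

section Canonical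

variable (θ : Stage13HParams F N) (hP : θ.Provisos₁₃CoPH F N) (K₀ : ℕ) (g₀ : ℕ → ℝ) (os : List (ULoop F)) (jcut : ℕ → ℕ)
  (ρ : WidthLetter₁₃CoPH N) (n : DepthLetter₁₃CoPH N)

/-- **THE GAPPED READING's CANONICAL FRACTION IS `≤ 1`** at every step, every tuple with core provisos. [cite: King1986, (3.10)–(3.11) p.656 (bookkeeping)] -/
theorem W_crGap₁₃VAt_le_one (K : ℕ) : (crGap₁₃VAt N K₀ jcut ρ n F θ hP g₀ os).W K ≤ 1 :=
  wInf_le_of_mem (one_mem_admW_carriersGap₁₃ θ hP K₀ g₀ os _ _ jcut K)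

/-- **… AND LIES IN `[0, 1]`.** [cite: King1986, (3.10)–(3.11) p.656 (bookkeeping)] -/
theorem W_crGap₁₃VAt_mem_Icc (K : ℕ) : (crGap₁₃VAt N K₀ jcut ρ n F θ hP g₀ os).W K ∈ Set.Icc (0 : ℝ) 1 :=
  ⟨wInf_nonneg K, W_crGap₁₃VAt_le_one θ hP K₀ g₀ os jcut ρ n K⟩

/-- **THE GAPPED READING's `W` IS A RELATIVE WEIGHT OF ITS PERSISTENCE CLASS, run A** — hypothesis-free: for every step `K` and source `|t| ≤ 1`,
`Σ_{x ∈ Bad K t} A K t x ≤ W K · Σ_{x ∈ T K} A K t x`. [cite: Balaban1989LargeFieldII, (1.80) p.384; King1986, (3.10)–(3.11) p.656 (bookkeeping)] -/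
theorem badMass_le_W_crGap₁₃VAt_left (K : ℕ) {t : ℝ} (ht : |t| ≤ 1) :
    ∑ x ∈ (crGap₁₃VAt N K₀ jcut ρ n F θ hP g₀ os).Bad K t, (crGap₁₃VAt N K₀ jcut ρ n F θ hP g₀ os).A K t x ≤
      (crGap₁₃VAt N K₀ jcut ρ n F θ hP g₀ os).W K * ∑ x ∈ (crGap₁₃VAt N K₀ jcut ρ n F θ hP g₀ os).T K, (crGap₁₃VAt N K₀ jcut ρ n F θ hP g₀ os).A K t x :=
  bad_left_wInf (fun K t _ x _ => gapWeightA₁₃_nonneg θ hP K₀ g₀ os _ _ K t x) (fun K t _ x _ => gapWeightB₁₃_nonneg θ hP K₀ g₀ os _ _ K t x)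
    (fun K t _ => badClass₁₃_subset θ K₀ g₀ jcut K t) K ht

/-- **… run B.** [cite: Balaban1989LargeFieldII, (1.80) p.384; King1986, (3.10)–(3.11) p.656 (bookkeeping)] -/
theorem badMass_le_W_crGap₁₃VAt_right (K : ℕ) {t : ℝ} (ht : |t| ≤ 1) :
    ∑ x ∈ (crGap₁₃VAt N K₀ jcut ρ n F θ hP g₀ os).Bad K t, (crGap₁₃VAt N K₀ jcut ρ n F θ hP g₀ os).B K t x ≤
      (crGap₁₃VAt N K₀ jcut ρ n F θ hP g₀ os).W K * ∑ x ∈ (crGap₁₃VAt N K₀ jcut ρ n F θ hP g₀ os).T K, (crGap₁₃VAt N K₀ jcut ρ n F θ hP g₀ os).B K t x :=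
  bad_right_wInf (fun K t _ x _ => gapWeightA₁₃_nonneg θ hP K₀ g₀ os _ _ K t x) (fun K t _ x _ => gapWeightB₁₃_nonneg θ hP K₀ g₀ os _ _ K t x)
    (fun K t _ => badClass₁₃_subset θ K₀ g₀ jcut K t) K ht

/-- **★★ THE N20 FACE AT THE GAPPED READING IS TWO NUMERIC CONDITIONS ON ITS OWN `W`** — every Stage-13 tuple with core provisos, every `K₀ jcut ρ n g₀ os`, HYPOTHESIS-FREE:
`RelWeightBound (cr…).l₀ (cr…).T (cr…).A (cr…).B (cr…).Bad (cr…).W ⟺ (∀ K, (cr…).W K < 1) ∧ Summable (cr…).W` for `cr… := crGap₁₃VAt N K₀ jcut ρ n F θ hP g₀ os`.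
[cite: Balaban1989LargeFieldII, Thm 1 + (0.1) pp.355–356, (1.80) p.384; King1986, (3.10)–(3.11) p.656 (bookkeeping)] -/
theorem relWeightBound_crGap₁₃VAt_iff :
    RelWeightBound (crGap₁₃VAt N K₀ jcut ρ n F θ hP g₀ os).l₀ (crGap₁₃VAt N K₀ jcut ρ n F θ hP g₀ os).T (crGap₁₃VAt N K₀ jcut ρ n F θ hP g₀ os).A
        (crGap₁₃VAt N K₀ jcut ρ n F θ hP g₀ os).B (crGap₁₃VAt N K₀ jcut ρ n F θ hP g₀ os).Bad (crGap₁₃VAt N K₀ jcut ρ n F θ hP g₀ os).W ↔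
      (∀ K, (crGap₁₃VAt N K₀ jcut ρ n F θ hP g₀ os).W K < 1) ∧ Summable (crGap₁₃VAt N K₀ jcut ρ n F θ hP g₀ os).W :=
  relWeightBound_wInf_iff_lt_one_summable (fun K t _ x _ => gapWeightA₁₃_nonneg θ hP K₀ g₀ os _ _ K t x)
    (fun K t _ x _ => gapWeightB₁₃_nonneg θ hP K₀ g₀ os _ _ K t x) fun K t _ => badClass₁₃_subset θ K₀ g₀ jcut K t

/-- **SOME WITNESS AT THE GAPPED CARRIERS ⟺ THE SAME TWO CONDITIONS ON THE READING's `W`** (n21-d's `relWeightBound_crGap₁₃VAt` transfers any witness; this is the converse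
bookkeeping: nothing is lost by reading N20 at the gapped pin through the canonical weight). [cite: Balaban1989LargeFieldII, (1.80) p.384; King1986, (3.10)–(3.11) p.656 (bookkeeping)] -/
theorem exists_relWeightBound_carriersGap₁₃_iff :
    (∃ W : ℕ → ℝ, RelWeightBound 1 (classSet₁₃ θ K₀ g₀) (gapWeightA₁₃ θ hP K₀ g₀ os (ρ F θ hP g₀ os) (n F θ hP g₀ os))
        (gapWeightB₁₃ θ hP K₀ g₀ os (ρ F θ hP g₀ os) (n F θ hP g₀ os)) (badClass₁₃ θ K₀ g₀ jcut) W) ↔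
      (∀ K, (crGap₁₃VAt N K₀ jcut ρ n F θ hP g₀ os).W K < 1) ∧ Summable (crGap₁₃VAt N K₀ jcut ρ n F θ hP g₀ os).W :=
  exists_relWeightBound_iff_lt_one_summable (fun K t _ x _ => gapWeightA₁₃_nonneg θ hP K₀ g₀ os _ _ K t x)
    (fun K t _ x _ => gapWeightB₁₃_nonneg θ hP K₀ g₀ os _ _ K t x) fun K t _ => badClass₁₃_subset θ K₀ g₀ jcut K t

end Canonical

/-! ## §4  The dial at the gapped reading: monotone at one step; `= 1` above the window on the live line -/

section Dial

variable (θ : Stage13HParams F N) (hP : θ.Provisos₁₃CoPH F N) (K₀ : ℕ) (g₀ : ℕ → ℝ) (os : List (ULoop F)) (ρ : WidthLetter₁₃CoPH N) (n : DepthLetter₁₃CoPH N)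

/-- **★ `jcut K ≤ jcut' K ⇒ W(jcut) K ≤ W(jcut') K`** at the gapped reading, every Stage-13 tuple with core provisos, hypothesis-free (dag-n20-w1's `badClass₁₃_mono_at` + g2's
`wInf_mono_of_subset_at`): a deeper cut books a larger persistence class and a larger canonical fraction. [cite: Balaban1989LargeFieldII, (1.80) p.384 (bookkeeping)] -/
theorem W_crGap₁₃VAt_mono_at {jcut jcut' : ℕ → ℕ} {K : ℕ} (h : jcut K ≤ jcut' K) :
    (crGap₁₃VAt N K₀ jcut ρ n F θ hP g₀ os).W K ≤ (crGap₁₃VAt N K₀ jcut' ρ n F θ hP g₀ os).W K :=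
  wInf_mono_of_subset_at (fun t _ x _ => gapWeightA₁₃_nonneg θ hP K₀ g₀ os _ _ K t x) (fun t _ x _ => gapWeightB₁₃_nonneg θ hP K₀ g₀ os _ _ K t x)
    (fun t _ => badClass₁₃_mono_at θ K₀ g₀ h t) (fun t _ => badClass₁₃_subset θ K₀ g₀ jcut' K t)

variable (E : B12.RunParams → ℝ)

/-- **★ ABOVE THE WINDOW THE GAPPED READING's CANONICAL FRACTION IS EXACTLY `1`** (live-selector pin `hsel`, (H-ζ)): `K₀ + K < jcut K ⇒ (crGap₁₃VAt N K₀ jcut ρ n …).W K = 1` —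
g2's `badClass₁₃ = classSet₁₃` at that step, n21-d's E1 at the gapped reading (`sum_classSet₁₃_gapWeightA₁₃_eq_schemeZ`) at `t = 0`, and the positivity of the dressed partition
function of record. [cite: Balaban1988Convergent, (2.18) p.257; Balaban1989LargeFieldII, (1.80) p.384; King1986, (3.10)–(3.11) p.656 (bookkeeping)] -/
theorem W_crGap₁₃VAt_eq_one_of_overCut (hsel : θ.ppSel = ppSelLiveOfRecord F N θ.ν θ.τ9 E (wOfRecord₉ F N θ.toStage9Params)) (hζm : ZetaMeasurable F N θ.ζ)
    {jcut : ℕ → ℕ} {K : ℕ} (hK : K₀ + K < jcut K) :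
    (crGap₁₃VAt N K₀ jcut ρ n F θ hP g₀ os).W K = 1 := by
  have hpos := schemeZ_pos_datumOfRecord₁₃CoPH θ hP g₀ os (K₀ + K) 0
  rw [← sum_classSet₁₃_gapWeightA₁₃_eq_schemeZ K₀ θ hP g₀ os E hsel hζm (ρ F θ hP g₀ os) (n F θ hP g₀ os) K 0] at hpos
  exact wInf_eq_one_of_bad_eq (fun K t _ x _ => gapWeightA₁₃_nonneg θ hP K₀ g₀ os _ _ K t x) (fun K t _ x _ => gapWeightB₁₃_nonneg θ hP K₀ g₀ os _ _ K t x)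
    (fun K t _ => badClass₁₃_subset θ K₀ g₀ jcut K t) (t₀ := 0) (by rw [abs_zero]; exact zero_le_one) (badClass₁₃_eq_classSet₁₃_of_overCut θ K₀ g₀ jcut K 0 hK) hpos

/-- **HENCE AN N20 WITNESS AT THE GAPPED READING KEEPS THE CUT INSIDE THE WINDOW** on the live line: `RelWeightBound` there ⇒ `∀ K, jcut K ≤ K₀ + K` (above the window `W K = 1`
contradicts `W K < 1`). [cite: Balaban1989LargeFieldII, (1.80) p.384; King1986, (3.10)–(3.11) p.656 (bookkeeping)] -/
theorem cut_le_of_relWeightBound_crGap₁₃VAt (hsel : θ.ppSel = ppSelLiveOfRecord F N θ.ν θ.τ9 E (wOfRecord₉ F N θ.toStage9Params)) (hζm : ZetaMeasurable F N θ.ζ)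
    {jcut : ℕ → ℕ}
    (h : RelWeightBound (crGap₁₃VAt N K₀ jcut ρ n F θ hP g₀ os).l₀ (crGap₁₃VAt N K₀ jcut ρ n F θ hP g₀ os).T (crGap₁₃VAt N K₀ jcut ρ n F θ hP g₀ os).A
      (crGap₁₃VAt N K₀ jcut ρ n F θ hP g₀ os).B (crGap₁₃VAt N K₀ jcut ρ n F θ hP g₀ os).Bad (crGap₁₃VAt N K₀ jcut ρ n F θ hP g₀ os).W) (K : ℕ) :
    jcut K ≤ K₀ + K := by
  by_contra hK
  have h1 := h.lt_one K
  rw [W_crGap₁₃VAt_eq_one_of_overCut θ hP K₀ g₀ os ρ n E hsel hζm (lt_of_not_ge hK)] at h1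
  exact lt_irrefl _ h1

end Dial

/-! ## §5  The wall at the gapped carriers: first-level saturation (DISPLAYED) makes every N20-admissible cut eventually the zero cut -/

section Wall

variable (θ : Stage13HParams F N) (hP : θ.Provisos₁₃CoPH F N) (K₀ : ℕ) (g₀ : ℕ → ℝ) (os : List (ULoop F)) (ρ : ℕ → ℝ) (n : ℕ → ℕ)

/-- **FRACTION EXTRACTION AT A CUTTING STEP, run A, gapped carriers**: a `RelWeightBound` at the policy-`jcut` class, a step with `1 ≤ jcut K`, a source `|t| ≤ 1` with positive
run-A gapped mass of which the FIRST-LEVEL class holds the fraction `c` ⇒ `c ≤ W K` (`T4BadClassBooking.le_weight_of_fraction_le`; dag-n20-w1's `badClass₁₃_levelOne_subset_of_one_le`).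
[cite: Balaban1989LargeFieldII, (1.80) p.384; King1986, (3.10)–(3.11) p.656 (bookkeeping)] -/
theorem le_weight_of_levelOne_fraction_carriersGap₁₃ {jcut : ℕ → ℕ} {W : ℕ → ℝ}
    (hW : RelWeightBound 1 (classSet₁₃ θ K₀ g₀) (gapWeightA₁₃ θ hP K₀ g₀ os ρ n) (gapWeightB₁₃ θ hP K₀ g₀ os ρ n) (badClass₁₃ θ K₀ g₀ jcut) W)
    {K : ℕ} (hK : 1 ≤ jcut K) {t c : ℝ} (ht : |t| ≤ 1) (hpos : 0 < ∑ x ∈ classSet₁₃ θ K₀ g₀ K, gapWeightA₁₃ θ hP K₀ g₀ os ρ n K t x)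
    (hc : c * ∑ x ∈ classSet₁₃ θ K₀ g₀ K, gapWeightA₁₃ θ hP K₀ g₀ os ρ n K t x ≤ ∑ x ∈ badClass₁₃ θ K₀ g₀ (fun _ => 1) K t, gapWeightA₁₃ θ hP K₀ g₀ os ρ n K t x) :
    c ≤ W K :=
  le_weight_of_fraction_le hW ht hpos
    (hc.trans (Finset.sum_le_sum_of_subset_of_nonneg (badClass₁₃_levelOne_subset_of_one_le θ K₀ g₀ hK t)
      fun x _ _ => gapWeightA₁₃_nonneg θ hP K₀ g₀ os ρ n K t x))

/-- **★ THE WALL AT THE GAPPED CARRIERS: UNDER EVENTUAL FIRST-LEVEL SATURATION EVERY N20-ADMISSIBLE POLICY IS EVENTUALLY THE ZERO CUT.**  If from some cutoff on the first-level class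
holds the fraction `c > 0` of run A's gapped mass at some admissible source (DISPLAYED — dag-n20-w3's count; NOT proved), then ANY `RelWeightBound` at the policy-`jcut` class of the
gapped carriers forces `jcut K = 0` for cofinitely many `K` (`c ≤ W K` infinitely often contradicts `Summable W`, `T4ShellCount.not_summable_of_frequently_le`).
[cite: Balaban1989LargeFieldII, (1.80) p.384; King1986, (3.10)–(3.11) p.656 (bookkeeping)] -/
theorem eventually_cut_eq_zero_of_relWeightBound_carriersGap₁₃ {c : ℝ} (hc : 0 < c)
    (hsat : ∀ᶠ K in atTop, ∃ t : ℝ, |t| ≤ 1 ∧ 0 < ∑ x ∈ classSet₁₃ θ K₀ g₀ K, gapWeightA₁₃ θ hP K₀ g₀ os ρ n K t x ∧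
      c * ∑ x ∈ classSet₁₃ θ K₀ g₀ K, gapWeightA₁₃ θ hP K₀ g₀ os ρ n K t x ≤ ∑ x ∈ badClass₁₃ θ K₀ g₀ (fun _ => 1) K t, gapWeightA₁₃ θ hP K₀ g₀ os ρ n K t x)
    {jcut : ℕ → ℕ} {W : ℕ → ℝ}
    (hW : RelWeightBound 1 (classSet₁₃ θ K₀ g₀) (gapWeightA₁₃ θ hP K₀ g₀ os ρ n) (gapWeightB₁₃ θ hP K₀ g₀ os ρ n) (badClass₁₃ θ K₀ g₀ jcut) W) :
    ∀ᶠ K in atTop, jcut K = 0 := by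
  by_contra h
  have hfr : ∃ᶠ K in atTop, jcut K ≠ 0 := Filter.not_eventually.1 h
  refine not_summable_of_frequently_le hc ((hsat.and_frequently hfr).mono fun K hK => ?_) hW.summable
  obtain ⟨⟨t, ht, hpos, hle⟩, hK⟩ := hK
  exact le_weight_of_levelOne_fraction_carriersGap₁₃ θ hP K₀ g₀ os ρ n hW (Nat.one_le_iff_ne_zero.2 hK) ht hpos hle

/-- **★ THE WALL AT THE GAPPED READING** (its canonical `W`): eventual first-level saturation of run A's gapped carriers (DISPLAYED) + `RelWeightBound` at `crGap₁₃VAt N K₀ jcut ρ n …` ⇒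
`∀ᶠ K, jcut K = 0` — where §2 says the face is free and the good class is everything. [cite: Balaban1989LargeFieldII, (1.80) p.384; King1986, (3.10)–(3.11) p.656 (bookkeeping)] -/
theorem eventually_cut_eq_zero_of_relWeightBound_crGap₁₃VAt (ρ' : WidthLetter₁₃CoPH N) (n' : DepthLetter₁₃CoPH N) {c : ℝ} (hc : 0 < c)
    (hsat : ∀ᶠ K in atTop, ∃ t : ℝ, |t| ≤ 1 ∧ 0 < ∑ x ∈ classSet₁₃ θ K₀ g₀ K, gapWeightA₁₃ θ hP K₀ g₀ os (ρ' F θ hP g₀ os) (n' F θ hP g₀ os) K t x ∧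
      c * ∑ x ∈ classSet₁₃ θ K₀ g₀ K, gapWeightA₁₃ θ hP K₀ g₀ os (ρ' F θ hP g₀ os) (n' F θ hP g₀ os) K t x ≤
        ∑ x ∈ badClass₁₃ θ K₀ g₀ (fun _ => 1) K t, gapWeightA₁₃ θ hP K₀ g₀ os (ρ' F θ hP g₀ os) (n' F θ hP g₀ os) K t x)
    {jcut : ℕ → ℕ}
    (h : RelWeightBound (crGap₁₃VAt N K₀ jcut ρ' n' F θ hP g₀ os).l₀ (crGap₁₃VAt N K₀ jcut ρ' n' F θ hP g₀ os).T (crGap₁₃VAt N K₀ jcut ρ' n' F θ hP g₀ os).A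
      (crGap₁₃VAt N K₀ jcut ρ' n' F θ hP g₀ os).B (crGap₁₃VAt N K₀ jcut ρ' n' F θ hP g₀ os).Bad (crGap₁₃VAt N K₀ jcut ρ' n' F θ hP g₀ os).W) :
    ∀ᶠ K in atTop, jcut K = 0 :=
  eventually_cut_eq_zero_of_relWeightBound_carriersGap₁₃ θ hP K₀ g₀ os _ _ hc hsat h

end Wall

/-! ## §6  The K3 binder shapes at the gapped reading (`N = 2`, per-tuple cut reading `jc`, n21-d's located `PinnedAtLiveGap` shape `cr … = crGap₁₃V (jc …) ρ n …`) -/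

section Shape

/-- **★★ THE `KeyedRelWeight` BODY AT THE GAPPED READING WITH THE ZERO CUT READING, SPELLED OUT, HOLDS UNCONDITIONALLY** (`N = 2`; every guarded admissible Stage-13 tuple with core
provisos, every `g₀`, `os` — the guards are not used): the N20 conjunct of a gapped pin at `jc ≡ 0` is closed by THIS name.  A skeleton composer obtains `KeyedRelWeight
(fun F θ hP g₀ os ↦ crGap₁₃V 2 (jc F θ hP g₀ os) ρ n F θ hP g₀ os)` at `jc := fun _ _ _ _ _ _ ↦ 0` from it by `fun F θ hP _ _ g₀ os ↦ …` (the `def` is the skeleton's).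
[cite: King1986, (3.10) p.656; Balaban1989LargeFieldII, Thm 1 + (0.1) pp.355–356 (bookkeeping)] -/
theorem keyedRelWeight_shape_crGap₁₃V_cutZero (ρ : WidthLetter₁₃CoPH 2) (n : DepthLetter₁₃CoPH 2) :
    ∀ (F : T4Family) (θ : Stage13HParams F 2) (hP : θ.Provisos₁₃CoPH F 2), (θ.ZhUnity F 2 ∧ θ.SlotsNondegenerate₁₃ F 2) → θ.Admissible F 2 →
      ∀ (g₀ : ℕ → ℝ) (os : List (ULoop F)),
        RelWeightBound (crGap₁₃V 2 (fun _ => 0) ρ n F θ hP g₀ os).l₀ (crGap₁₃V 2 (fun _ => 0) ρ n F θ hP g₀ os).T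
          (crGap₁₃V 2 (fun _ => 0) ρ n F θ hP g₀ os).A (crGap₁₃V 2 (fun _ => 0) ρ n F θ hP g₀ os).B
          (crGap₁₃V 2 (fun _ => 0) ρ n F θ hP g₀ os).Bad (crGap₁₃V 2 (fun _ => 0) ρ n F θ hP g₀ os).W :=
  fun _ θ hP _ _ g₀ os => relWeightBound_crGap₁₃VAt_cutZero θ hP 0 g₀ os ρ n

/-- **THE `KeyedRelWeight` BODY AT THE PER-TUPLE-CUT GAPPED READING ⟺ THE KEYED FAMILY OF THE TWO NUMERIC CONDITIONS** (`N = 2`; the guards are not used).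
[cite: Balaban1989LargeFieldII, Thm 1 + (0.1) pp.355–356, (1.80) p.384; King1986, (3.10)–(3.11) p.656 (bookkeeping)] -/
theorem keyedRelWeight_shape_crGap₁₃V_iff
    (jc : (F : T4Family) → (θ : Stage13HParams F 2) → θ.Provisos₁₃CoPH F 2 → (ℕ → ℝ) → List (ULoop F) → ℕ → ℕ) (ρ : WidthLetter₁₃CoPH 2) (n : DepthLetter₁₃CoPH 2) :
    (∀ (F : T4Family) (θ : Stage13HParams F 2) (hP : θ.Provisos₁₃CoPH F 2), (θ.ZhUnity F 2 ∧ θ.SlotsNondegenerate₁₃ F 2) → θ.Admissible F 2 →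
      ∀ (g₀ : ℕ → ℝ) (os : List (ULoop F)),
        RelWeightBound (crGap₁₃V 2 (jc F θ hP g₀ os) ρ n F θ hP g₀ os).l₀ (crGap₁₃V 2 (jc F θ hP g₀ os) ρ n F θ hP g₀ os).T
          (crGap₁₃V 2 (jc F θ hP g₀ os) ρ n F θ hP g₀ os).A (crGap₁₃V 2 (jc F θ hP g₀ os) ρ n F θ hP g₀ os).B
          (crGap₁₃V 2 (jc F θ hP g₀ os) ρ n F θ hP g₀ os).Bad (crGap₁₃V 2 (jc F θ hP g₀ os) ρ n F θ hP g₀ os).W) ↔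
    (∀ (F : T4Family) (θ : Stage13HParams F 2) (hP : θ.Provisos₁₃CoPH F 2), (θ.ZhUnity F 2 ∧ θ.SlotsNondegenerate₁₃ F 2) → θ.Admissible F 2 →
      ∀ (g₀ : ℕ → ℝ) (os : List (ULoop F)),
        (∀ K, (crGap₁₃V 2 (jc F θ hP g₀ os) ρ n F θ hP g₀ os).W K < 1) ∧ Summable (crGap₁₃V 2 (jc F θ hP g₀ os) ρ n F θ hP g₀ os).W) :=
  forall₅_congr fun F θ hP _ _ => forall₂_congr fun g₀ os => relWeightBound_crGap₁₃VAt_iff θ hP 0 g₀ os (jc F θ hP g₀ os) ρ n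

end Shape

end Summit.QuantumFields.YangMills.BalabanUVNodes.N20KeyedRelWeightAtGappedReading

end
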